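import Literature.AlgebraicGeometry.Resolution.KollarMaxContactCharts
import Literature.AlgebraicGeometry.Resolution.MarkedIdealsLemmas
import Literature.AlgebraicGeometry.Resolution.RegularLocalRingsProofs
import HarnessLib

/-!
# Maximal-contact charts are preserved under disjoint unions (Kollár, proof of 3.103, Step 2)

Topic: `Literature/AlgebraicGeometry/Resolution`. Hypothesis (2.ii) of the globalization theorem
3.105 (`Kollar2007.GlobalizationHyp.union`, `KollarGlobalizationFunctor.lean`) for the class of
maximal-contact charts `Kollar2007.MaxContactChart n m` (`KollarMaxContactCharts.lean`): Kollár,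
proof of Thm. 3.103, Step 2 — "Here we assume that there is a smooth hypersurface of maximal
contact `H ⊂ X`. … This condition is also preserved under disjoint unions."

* `Kollar2007.MaxContactChart.union` — for any finite family of opens `U_i ⊆ X` (the shape of
  `GlobalizationHyp.union`; covering is not needed) whose charts `(U_i, I|_{U_i}, E|_{U_i})` are
  maximal-contact charts, the disjoint union `(∐ U_i, g^*I, g^{-1}E)`
  (`Triple.comapLocalIso (coverMap U)`) is one. The hypersurface ideals `H_i` glue to the vanishing
  ideal `H'` of the closed set `⋃ ι_i(V(H_i))`; `H'` restricts to `H_i` on each summand because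
  the `H_i` are radical — `Scheme.IdealSheafData.radical_eq_of_generator_notMem_sq`: an ideal
  generated along its support by order-one elements of regular local rings has prime stalks
  (`IsRegularLocalRing.quotient_span_singleton`, `isDomain_of_isRegularLocalRing`); the inclusion
  `H' ⊆ MC(I')` and the order-one condition are read off summand by summand
  (`Scheme.IdealSheafData.le_of_forall_comap_sigmaι_le`, `derivIdealSheafIter_comap_of_isLocalIso`,
  the stalk isomorphisms of the injections `ι_i`).
* Auxiliary: `isOpenImmersion_sigmaι` (instance, via `sigmaOpenCover`), `isClosed_range_sigmaι`,
  `isClosed_image_sigmaι`, `preimage_sigmaι_iUnion_image`, `Triple.maxOrdLE_coverMap` and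
  `LTCover.maxOrdLE` (`max-ord ≤ m` summandwise / is local on open covers,
  `idealOrder_comap_of_etale`), `LTCover.maxContactChart_coverMap` (the covering case).

## Sources

* J. Kollár, *Lectures on Resolution of Singularities* (2007): proof of Thm. 3.103 (Step 2),
  Thm. 3.105 (2.ii). [Kollar2007]
-/

noncomputable section

open CategoryTheory CategoryTheory.Limits AlgebraicGeometry TopologicalSpace IsLocalRing

namespace Literature.AlgebraicGeometry.Resolution

universe u

/-! ## Closed sets and ideal sheaves on finite disjoint unions -/

section Sigma

variable {ι : Type u} {Y : ι → Scheme.{u}}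

/-- The coproduct injections `Y_i → ∐ Y` are open immersions (Mathlib: via `sigmaOpenCover`).
[folklore] -/
instance isOpenImmersion_sigmaι (i : ι) : IsOpenImmersion (Sigma.ι Y i) :=
  inferInstanceAs (IsOpenImmersion ((sigmaOpenCover Y).f i))

/-- The coproduct injections have closed range (the complement is the union of the other
ranges). [folklore] -/
theorem isClosed_range_sigmaι (i : ι) : IsClosed (Set.range ⇑(Sigma.ι Y i)) := by
  rw [← isOpen_compl_iff]
  have : (Set.range ⇑(Sigma.ι Y i))ᶜ = ⋃ j ∈ {j | j ≠ i}, Set.range ⇑(Sigma.ι Y j) := by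
    ext z
    simp only [Set.mem_compl_iff, Set.mem_range, not_exists, Set.mem_setOf_eq, Set.mem_iUnion,
      exists_prop]
    constructor
    · intro hz
      obtain ⟨j, y, rfl⟩ := exists_sigmaι_eq z
      exact ⟨j, fun hji => hz (hji ▸ y) (by subst hji; rfl), y, rfl⟩
    · rintro ⟨j, hji, y, rfl⟩ y' he
      have := (eq_bot_iff.mp <| disjoint_iff.mp <| disjoint_opensRange_sigmaι Y j i hji)
        (show Sigma.ι Y j y ∈ (Sigma.ι Y j).opensRange ⊓ (Sigma.ι Y i).opensRange from
          ⟨⟨y, rfl⟩, ⟨y', he⟩⟩)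
      simp at this
  rw [this]
  exact isOpen_biUnion fun j _ => (Sigma.ι Y j).isOpenEmbedding.isOpen_range

/-- Images of closed sets under the coproduct injections are closed. [folklore] -/
theorem isClosed_image_sigmaι (i : ι) {C : Set (Y i)} (hC : IsClosed C) :
    IsClosed (Sigma.ι Y i '' C) := by
  have hemb := (Sigma.ι Y i).isOpenEmbedding
  rw [← isOpen_compl_iff]
  have : (⇑(Sigma.ι Y i) '' C)ᶜ = (Set.range ⇑(Sigma.ι Y i))ᶜ ∪ Sigma.ι Y i '' Cᶜ := by
    ext z
    constructor
    · intro hz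
      by_cases hr : z ∈ Set.range ⇑(Sigma.ι Y i)
      · obtain ⟨y, rfl⟩ := hr
        exact Or.inr ⟨y, fun hy => hz ⟨y, hy, rfl⟩, rfl⟩
      · exact Or.inl hr
    · rintro (hz | ⟨y, hy, rfl⟩) ⟨y', hy', he⟩
      · exact hz ⟨y', he⟩
      · exact hy (hemb.injective he ▸ hy')
  rw [this]
  exact (isClosed_range_sigmaι i).isOpen_compl.union (hemb.isOpenMap _ hC.isOpen_compl)

/-- Preimage under `ι_i` of the union of the images `ι_j(C_j)` is `C_i`. [folklore] -/
theorem preimage_sigmaι_iUnion_image (C : ∀ j, Set (Y j)) (i : ι) :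
    Sigma.ι Y i ⁻¹' (⋃ j, Sigma.ι Y j '' C j) = C i := by
  ext y
  simp only [Set.mem_preimage, Set.mem_iUnion, Set.mem_image]
  constructor
  · rintro ⟨j, y', hy', he⟩
    obtain ⟨rfl, h2⟩ := Sigma.mk.inj ((sigmaι_eq_iff Y j i y' y).mp he)
    exact (eq_of_heq h2) ▸ hy'
  · exact fun hy => ⟨i, y, hy, rfl⟩

/-- Comparison of ideal sheaves on `∐ Y_i` chart by chart. [folklore] -/
theorem Scheme.IdealSheafData.le_of_forall_comap_sigmaι_le {K L : (∐ Y).IdealSheafData}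
    (h : ∀ i, K.comap (Sigma.ι Y i) ≤ L.comap (Sigma.ι Y i)) : K ≤ L := by
  refine le_of_forall_stalkIdeal_le fun z => ?_
  obtain ⟨i, y, rfl⟩ := exists_sigmaι_eq z
  have h1 := stalkIdeal_mono (h i) y
  rw [stalkIdeal_comap_of_isLocalIso, stalkIdeal_comap_of_isLocalIso] at h1
  have h2 := Ideal.comap_mono (f := stalkEquivOfIsLocalIso (Sigma.ι Y i) y) h1
  rwa [Ideal.comap_map_of_bijective _ (stalkEquivOfIsLocalIso (Sigma.ι Y i) y).bijective,
    Ideal.comap_map_of_bijective _ (stalkEquivOfIsLocalIso (Sigma.ι Y i) y).bijective] at h2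

end Sigma

/-- A locally principal ideal sheaf generated along its support by elements of order one (the
ideal of a smooth hypersurface in a regular scheme) is radical: its stalks are `⊤` or prime
(`𝒪_x/(v)` is a regular local ring, hence a domain). [folklore] -/
theorem Scheme.IdealSheafData.radical_eq_of_generator_notMem_sq {X : Scheme.{u}}
    (hX : Scheme.IsRegular X) {H : X.IdealSheafData}
    (hH : ∀ y ∈ H.support, ∃ v : X.presheaf.stalk y,
      stalkIdeal H y = Ideal.span {v} ∧ v ∉ (maximalIdeal (X.presheaf.stalk y)) ^ 2) :
    H.radical = H := by
  rw [radical_eq_iff_forall_stalkIdeal]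
  intro x
  by_cases hx : x ∈ H.support
  · obtain ⟨v, hv, hv2⟩ := hH x hx
    haveI := hX x
    have hvm : v ∈ maximalIdeal (X.presheaf.stalk x) := by
      have hle := (mem_support_iff_stalkIdeal_le H x).mp hx
      rw [hv, Ideal.span_le, Set.singleton_subset_iff] at hle
      exact hle
    haveI := (IsRegularLocalRing.quotient_span_singleton hvm hv2).1
    haveI : IsDomain (X.presheaf.stalk x ⧸ Ideal.span {v}) := isDomain_of_isRegularLocalRing _
    rw [hv]
    exact ((Ideal.Quotient.isDomain_iff_prime _).mp this).isRadical
  · rw [stalkIdeal_eq_top_of_not_mem_support hx]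
    exact (Ideal.radical_top _).le

namespace Kollar2007

variable {k : Type u} [Field k] {n m : ℕ}

/-- The `max-ord ≤ m` condition is local: it holds for `T` once it holds on the charts of an open
cover. [folklore] -/
theorem LTCover.maxOrdLE [CharZero k] {LT : TripleClass.{u} n} {T : Triple k n} (U : LTCover LT T)
    (h : ∀ i, (T.comapLocalIso (U.U i).ι).MaxOrdLE m) : T.MaxOrdLE m := by
  intro x
  have hx : x ∈ (⊤ : T.X.Opens) := trivial
  rw [← U.iSup_eq, Opens.mem_iSup] at hx
  obtain ⟨i, hi⟩ := hx
  have h1 := h i ⟨x, hi⟩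
  change idealOrder (T.ideal.comap (U.U i).ι) ⟨x, hi⟩ ≤ m at h1
  haveI : Flat (U.U i).ι := flat_of_isLocalIso _
  haveI : FormallyUnramified (U.U i).ι := formallyUnramified_of_isLocalIso _
  rwa [idealOrder_comap_of_etale] at h1

/-- `max-ord ≤ m` on a finite disjoint union of charts, summand by summand. [folklore] -/
theorem Triple.maxOrdLE_coverMap [CharZero k] {T : Triple k n} {ι : Type u} [Finite ι]
    (U : ι → T.X.Opens) (h : ∀ i, (T.comapLocalIso (U i).ι).MaxOrdLE m) :
    (T.comapLocalIso (coverMap U)).MaxOrdLE m := by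
  intro z
  obtain ⟨i, y, rfl⟩ := exists_sigmaι_eq z
  let j := Sigma.ι (fun i => ((U i : T.X.Opens) : Scheme.{u})) i
  haveI : Flat j := flat_of_isLocalIso _
  haveI : FormallyUnramified j := formallyUnramified_of_isLocalIso _
  haveI : LocallyOfFiniteType j := locallyOfFiniteType_of_isLocalIso _
  have h1 := h i y
  change idealOrder (T.ideal.comap (U i).ι) y ≤ m at h1
  change idealOrder (T.ideal.comap (coverMap U)) (j y) ≤ m
  rwa [← idealOrder_comap_of_etale j, ← Scheme.IdealSheafData.comap_comp, ι_coverMap]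

/-- **Maximal-contact charts are preserved under disjoint unions** (hypothesis (2.ii) of 3.105 in
the shape of `GlobalizationHyp.union`: an arbitrary finite family of open charts, not necessarily
covering; Kollár, proof of 3.103, Step 2: "This condition is also preserved under disjoint
unions"): if the charts `(U_i, I|_{U_i}, E|_{U_i})` are maximal-contact charts, so is
`(∐ U_i, g^*I, g^{-1}E)`. On `X' = ∐ U_i` the hypersurface ideals `H_i` glue to the ideal `H'` of
the (disjoint) union of the `V(H_i)` — the vanishing ideal of that closed set, which restricts to
`H_i` on each summand because the `H_i` are radical (`radical_eq_of_generator_notMem_sq`);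
`max-ord ≤ m`, `H' ⊆ MC(I')` and the order-one condition are checked summand by summand
(`Triple.maxOrdLE_coverMap`, `derivIdealSheafIter_comap_of_isLocalIso`).
[cite: Kollar2007, Thm. 3.103 (proof, Step 2)] -/
theorem MaxContactChart.union [CharZero k] {T : Triple k n} {ι : Type u} [Finite ι]
    (U : ι → T.X.Opens) (hU : ∀ i, MaxContactChart n m (T.comapLocalIso (U i).ι)) :
    MaxContactChart n m (T.comapLocalIso (coverMap U)) := by
  classical
  choose H hH hreg using fun i => (hU i).2
  let Y : ι → Scheme.{u} := fun i => ((U i : T.X.Opens) : Scheme.{u})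
  refine ⟨Triple.maxOrdLE_coverMap U fun i => (hU i).1, ?_⟩
  -- the glued hypersurface ideal: the vanishing ideal of `⋃ ι_i(V(H_i))`
  let S : Set ↑(∐ Y) := ⋃ i, Sigma.ι Y i '' ((H i).support : Set (Y i))
  have hS : IsClosed S :=
    isClosed_iUnion_of_finite fun i => isClosed_image_sigmaι i (H i).support.isClosed
  let H' : (∐ Y).IdealSheafData := Scheme.IdealSheafData.vanishingIdeal ⟨S, hS⟩
  have hH' : ∀ i, H'.comap (Sigma.ι Y i) = H i := by
    intro i
    rw [comap_vanishingIdeal_of_isOpenImmersion]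
    have : (⟨S, hS⟩ : Closeds _).preimage (Sigma.ι Y i).continuous = (H i).support := by
      ext1
      exact preimage_sigmaι_iUnion_image (fun j => ((H j).support : Set (Y j))) i
    rw [this, Scheme.IdealSheafData.vanishingIdeal_support]
    exact Scheme.IdealSheafData.radical_eq_of_generator_notMem_sq
      (T.comapLocalIso (U i).ι).isRegular (hreg i)
  -- the `k`-structures of the summands
  have hcomp : ∀ i, (Sigma.ι Y i).appTop.hom.comp (T.comapLocalIso (coverMap U)).kHom =
      (U i).ι.appTop.hom.comp T.kHom := by
    intro i
    rw [Triple.kHom_comapLocalIso, ← RingHom.comp_assoc, ← CommRingCat.hom_comp,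
      ← Scheme.Hom.comp_appTop, ι_coverMap]
  refine ⟨H', ?_, ?_⟩
  · -- `H' ⊆ MC(I')`, checked on each summand
    refine Scheme.IdealSheafData.le_of_forall_comap_sigmaι_le fun i => ?_
    have hφ := (T.comapLocalIso (coverMap U)).hasFinitePresentationDifferentials_kHom
    have hφi := (T.comapLocalIso (U i).ι).hasFinitePresentationDifferentials_kHom
    rw [Triple.kHom_comapLocalIso] at hφi
    rw [← hcomp i] at hφi
    rw [hH']
    change H i ≤ (derivIdealSheafIter (T.comapLocalIso (coverMap U)).kHom (m - 1)
      (T.ideal.comap (coverMap U))).comap (Sigma.ι Y i)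
    rw [derivIdealSheafIter_comap_of_isLocalIso _ (Sigma.ι Y i) hφ hφi, hcomp i,
      ← Scheme.IdealSheafData.comap_comp, ι_coverMap]
    have h2 := hH i
    rwa [maxContactIdealSheaf, Triple.kHom_comapLocalIso] at h2
  · -- order one along `V(H')`, read off on the summand through the point
    intro z hz
    obtain ⟨i, y, rfl⟩ := exists_sigmaι_eq z
    have hy : y ∈ (H i).support := by
      rw [← hH' i]
      have : y ∈ ((H'.comap (Sigma.ι Y i)).support : Set (Y i)) := by
        rw [Scheme.IdealSheafData.support_comap]
        exact hz
      exact this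
    obtain ⟨v, hv, hv2⟩ := hreg i y hy
    let e := stalkEquivOfIsLocalIso (Sigma.ι Y i) y
    refine ⟨e.symm v, ?_, (notMem_sq_maximalIdeal_iff_of_ringEquiv e.symm v).mp hv2⟩
    have h1 : (stalkIdeal H' (Sigma.ι Y i y)).map e = Ideal.span {v} := by
      rw [← hv, ← stalkIdeal_comap_of_isLocalIso, hH' i]
    calc stalkIdeal H' (Sigma.ι Y i y)
        = ((stalkIdeal H' (Sigma.ι Y i y)).map e).comap e :=
          (Ideal.comap_map_of_bijective e e.bijective).symm
      _ = (Ideal.span {v}).comap e := by rw [h1]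
      _ = Ideal.span {e.symm v} := by
          rw [← Ideal.map_symm, Ideal.map_span, Set.image_singleton]

/-- The covering-family case: the disjoint union of an `𝓛𝓣`-cover by maximal-contact charts is
a maximal-contact chart. [folklore] -/
theorem LTCover.maxContactChart_coverMap [CharZero k] {T : Triple k n}
    (c : LTCover (MaxContactChart n m) T) : MaxContactChart n m (T.comapLocalIso (coverMap c.U)) :=
  MaxContactChart.union c.U c.mem

end Kollar2007

end Literature.AlgebraicGeometry.Resolution

end
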